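import Mathlib.Geometry.Manifold.SmoothEmbedding
import Mathlib.Geometry.Manifold.Instances.Real
import Mathlib.Geometry.Manifold.IsManifold.InteriorBoundary
import Mathlib.Geometry.Manifold.MFDeriv.Basic
import Mathlib.Geometry.Manifold.VectorBundle.Riemannian
import Mathlib.Geometry.Manifold.VectorBundle.Tangent
import Literature.Geometry.Lorentzian.PseudoRiemannianMetric
import Literature.Geometry.Lorentzian.LeviCivita
import HarnessLib

/-!
# Conformally compact fillings and Poincaré–Einstein fillings of a closed Riemannian manifold

The package "`(N, g)` is a `C²`-conformally compact, boundary-normalised Riemannian manifold whose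
conformal infinity is `(M, [g₀])`", as used (inlined verbatim, nine conjuncts) by every item of the
route `Summits/SmoothPoincare4/SmoothPoincare4/Theses/EinsteinBulk.lean` (`PEFillNearRound`,
`PEFilledHomotopySpheres`, `YamabePinchedEinsteinBulk`, `EinsteinHadamardFillingStandard`,
`HadamardFillingStandard`, `RoundSphereBoundsHyperbolicSpace`), vendored as the predicates
`IsConformallyCompactFilling M g₀ N g` (closed smooth 4-manifold `M`, boundaryless smooth
5-manifold `N`) and `IsPoincareEinsteinFilling M g₀ N g` (the same with `Ric_g = −4 g`), together
with the dimension-general forms `IsConformallyCompactFillingOfDim n` / `IsPoincareEinsteinFillingOfDim n`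
(`dim M = n`, `dim N = n + 1`, `Ric_g = −n g`).

Sources for the informal notion. G. Li, J. Qing, Y. Shi, *Gap phenomena and curvature estimates
for conformally compact Einstein manifolds*, Trans. AMS 369 (2017) (`LiQingShi2017`; held:
arXiv:1410.6402, Def. 2.1 read on PDF p. 6): "Suppose that `Xⁿ` is the interior of a smooth compact
manifold `X̄ⁿ` with boundary `∂Xⁿ⁻¹`. A Riemannian metric `g⁺` on `Xⁿ` is said to be conformally
compact of `C^{k,α}` regularity if, for a smooth defining function `x` for the boundary `∂Xⁿ⁻¹` in
`X̄ⁿ`, `ḡ = x² g⁺` can be extended to a `C^{k,α}` Riemannian metric on `X̄ⁿ`. If, in addition,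
`|dx|²_{x²g⁺}|_{x=0} = 1`, then we say `(Xⁿ, g⁺)` is asymptotically hyperbolic … And if, in addition,
`g⁺` is at least of `C²` regularity and Einstein, that is, `Ric[g⁺] = −(n−1) g⁺`, then we say
`(Xⁿ, g⁺)` is a conformally compact Einstein manifold. A smooth defining function `x` for the
boundary … is a smooth nonnegative function from `X̄ⁿ` such that `x > 0` in the interior; `x = 0` on
the boundary; `dx ≠ 0` on the boundary. … The conformal manifold `(∂Xⁿ⁻¹, [ĝ])` is called the
conformal infinity"; C. R. Graham, J. M. Lee, Adv. Math. 87 (1991) (`GrahamLee1991`); J. M. Lee,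
*Fredholm operators and Einstein metrics on conformally compact manifolds*, Mem. AMS 864 (2006),
§1 (`Lee2006`).

## Rendering (the nine conjuncts, kept literally as in the route items)

Given a closed smooth `M` (model `𝓡 n`) with a `C^∞` Riemannian metric `g₀`
(`Bundle.ContMDiffRiemannianMetric` on the tangent bundle) and a boundaryless smooth `N` (model
`𝓡 (n+1)`) with a `C^∞` Riemannian metric `g`, `IsConformallyCompactFillingOfDim n M g₀ N g` says:
there are a compact connected `C^∞` manifold with boundary `X̄` (model `𝓡∂ (n+1)`), maps
`j : N → X̄`, `ι : M → X̄`, `ρ : X̄ → ℝ` and a `C²` Riemannian metric `ḡ` on `X̄` such that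
(1) `j` is a smooth embedding, (2) onto the interior of `X̄`, (3) `ι` is a smooth embedding, (4) onto
the boundary of `X̄`, (5) `ρ` is smooth, (6) `ρ ≥ 0`, (7) `ρ = 0` exactly on the boundary (so
`ρ > 0` on the interior: a defining function, with (8) replacing `dρ ≠ 0`), (8) boundary
normalisation `|dρ|_ḡ = 1` on `∂X̄`, in the form: at each `ι y` there is a `ḡ`-unit vector `ν` with
`ḡ(ν, ·) = dρ` (the `ḡ`-gradient of `ρ` is a unit vector), (9a) `j^*ḡ = (ρ ∘ j)² g` (i.e.
`ḡ = ρ² g⁺` on the interior, `g⁺ = j_* g`), and (9b) `ι^*ḡ = φ g₀` for a positive function `φ`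
(the conformal infinity is `[g₀]`). `IsPoincareEinsteinFillingOfDim n` adds `Ric_g = −n g`
(`PseudoRiemannianMetric.ricci` of `ofRiemannian g`, which needs the Levi-Civita instance
`[(ofRiemannian g).HasLeviCivita]`). The fixed-dimension predicates `IsConformallyCompactFilling` /
`IsPoincareEinsteinFilling` are the case `n = 4` written with the literals `4`, `5`, `−4` exactly as
the route items inline it, so that those items are restated by `Iff.rfl`
(`isConformallyCompactFilling_iff_ofDim`).

Not here: existence of geodesic defining functions, independence of the conformal infinity from
`ρ`, the hyperbolic ball as the model example (which would witness non-vacuity; not formalised).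
-/

noncomputable section

open scoped Manifold ContDiff
open Bundle Literature.Geometry.Lorentzian

namespace Literature.Geometry.Riemannian

/-! ### Dimension-general predicates -/

/-- **`(N, g)` is a `C²`-conformally compact, boundary-normalised filling with conformal infinity
`(M, [g₀])`**, `dim M = n`, `dim N = n + 1` (Li–Qing–Shi Def. 2.1 with the AH normalisation
`|dρ|_ḡ = 1` on the boundary; Graham–Lee 1991; Lee 2006 §1): see the module docstring for the nine
conjuncts (compactification `X̄` with boundary, embeddings `j : N ≅ int X̄`, `ι : M ≅ ∂X̄`, smooth
defining function `ρ`, `C²` metric `ḡ` on `X̄` with `j^*ḡ = ρ² g` and `ι^*ḡ` conformal to `g₀`).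
[cite: LiQingShi2017, Def. 2.1] -/
def IsConformallyCompactFillingOfDim (n : ℕ) (M : Type) [TopologicalSpace M]
    [ChartedSpace (EuclideanSpace ℝ (Fin n)) M] [IsManifold (𝓡 n) ∞ M]
    (g₀ : Bundle.ContMDiffRiemannianMetric (𝓡 n) ∞ (EuclideanSpace ℝ (Fin n))
      (TangentSpace (𝓡 n) : M → Type _))
    (N : Type) [TopologicalSpace N] [ChartedSpace (EuclideanSpace ℝ (Fin (n + 1))) N]
    [IsManifold (𝓡 (n + 1)) ∞ N]
    (g : Bundle.ContMDiffRiemannianMetric (𝓡 (n + 1)) ∞ (EuclideanSpace ℝ (Fin (n + 1)))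
      (TangentSpace (𝓡 (n + 1)) : N → Type _)) : Prop :=
  ∃ (X : Type) (_ : TopologicalSpace X) (_ : T2Space X) (_ : SecondCountableTopology X)
    (_ : ChartedSpace (EuclideanHalfSpace (n + 1)) X) (_ : IsManifold (𝓡∂ (n + 1)) ∞ X)
    (_ : CompactSpace X) (_ : ConnectedSpace X) (j : N → X) (ι : M → X) (ρ : X → ℝ)
    (gb : Bundle.ContMDiffRiemannianMetric (𝓡∂ (n + 1)) 2 (EuclideanSpace ℝ (Fin (n + 1)))
      (TangentSpace (𝓡∂ (n + 1)) : X → Type _)),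
    Manifold.IsSmoothEmbedding (𝓡 (n + 1)) (𝓡∂ (n + 1)) ∞ j ∧
    Set.range j = (𝓡∂ (n + 1)).interior X ∧
    Manifold.IsSmoothEmbedding (𝓡 n) (𝓡∂ (n + 1)) ∞ ι ∧
    Set.range ι = (𝓡∂ (n + 1)).boundary X ∧
    ContMDiff (𝓡∂ (n + 1)) 𝓘(ℝ, ℝ) ∞ ρ ∧ (∀ x : X, 0 ≤ ρ x) ∧
    (∀ x : X, ρ x = 0 ↔ x ∈ (𝓡∂ (n + 1)).boundary X) ∧
    (∀ y : M, ∃ ν : TangentSpace (𝓡∂ (n + 1)) (ι y), gb.inner (ι y) ν ν = 1 ∧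
      ∀ v : TangentSpace (𝓡∂ (n + 1)) (ι y),
        gb.inner (ι y) ν v = mfderiv (𝓡∂ (n + 1)) 𝓘(ℝ, ℝ) ρ (ι y) v) ∧
    (∀ (x : N) (v w : TangentSpace (𝓡 (n + 1)) x),
      gb.inner (j x) (mfderiv (𝓡 (n + 1)) (𝓡∂ (n + 1)) j x v)
        (mfderiv (𝓡 (n + 1)) (𝓡∂ (n + 1)) j x w) = ρ (j x) ^ 2 * g.inner x v w) ∧
    (∃ φ : M → ℝ, ∀ y : M, 0 < φ y ∧ ∀ v w : TangentSpace (𝓡 n) y,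
      gb.inner (ι y) (mfderiv (𝓡 n) (𝓡∂ (n + 1)) ι y v) (mfderiv (𝓡 n) (𝓡∂ (n + 1)) ι y w) =
        φ y * g₀.inner y v w)

/-- **Poincaré–Einstein filling**, `dim M = n`, `dim N = n + 1`: a conformally compact filling
(`IsConformallyCompactFillingOfDim`) whose bulk metric is Einstein with `Ric_g = −n·g` (Li–Qing–Shi
Def. 2.1: "`Ric[g⁺] = −(n−1) g⁺`" for `dim = n` there, i.e. `−n` for `dim N = n + 1`; conformally
compact Einstein manifold). The Ricci tensor is the tree's `PseudoRiemannianMetric.ricci` of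
`ofRiemannian g` and needs its Levi-Civita instance. [cite: LiQingShi2017, Def. 2.1] -/
def IsPoincareEinsteinFillingOfDim (n : ℕ) (M : Type) [TopologicalSpace M]
    [ChartedSpace (EuclideanSpace ℝ (Fin n)) M] [IsManifold (𝓡 n) ∞ M]
    (g₀ : Bundle.ContMDiffRiemannianMetric (𝓡 n) ∞ (EuclideanSpace ℝ (Fin n))
      (TangentSpace (𝓡 n) : M → Type _))
    (N : Type) [TopologicalSpace N] [ChartedSpace (EuclideanSpace ℝ (Fin (n + 1))) N]
    [IsManifold (𝓡 (n + 1)) ∞ N]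
    (g : Bundle.ContMDiffRiemannianMetric (𝓡 (n + 1)) ∞ (EuclideanSpace ℝ (Fin (n + 1)))
      (TangentSpace (𝓡 (n + 1)) : N → Type _))
    [(PseudoRiemannianMetric.ofRiemannian g).HasLeviCivita] : Prop :=
  (∀ x, (PseudoRiemannianMetric.ofRiemannian g).ricci x =
      (-(n : ℝ)) • (PseudoRiemannianMetric.ofRiemannian g).toBilinForm x) ∧
    IsConformallyCompactFillingOfDim n M g₀ N g

/-! ### Dimension four (the literal form inlined in route `EinsteinBulk`) -/

/-- **`(N⁵, g)` is a `C²`-conformally compact, boundary-normalised filling with conformal infinity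
the closed 4-manifold `(M, [g₀])`** — the nine-conjunct package inlined verbatim in the items of
route `SmoothPoincare4/EinsteinBulk` (module docstring), i.e. `IsConformallyCompactFillingOfDim 4`
with the literals `4`, `5` (`isConformallyCompactFilling_iff_ofDim`).
[cite: LiQingShi2017, Def. 2.1] -/
def IsConformallyCompactFilling (M : Type) [TopologicalSpace M]
    [ChartedSpace (EuclideanSpace ℝ (Fin 4)) M] [IsManifold (𝓡 4) ∞ M]
    (g₀ : Bundle.ContMDiffRiemannianMetric (𝓡 4) ∞ (EuclideanSpace ℝ (Fin 4))
      (TangentSpace (𝓡 4) : M → Type _))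
    (N : Type) [TopologicalSpace N] [ChartedSpace (EuclideanSpace ℝ (Fin 5)) N]
    [IsManifold (𝓡 5) ∞ N]
    (g : Bundle.ContMDiffRiemannianMetric (𝓡 5) ∞ (EuclideanSpace ℝ (Fin 5))
      (TangentSpace (𝓡 5) : N → Type _)) : Prop :=
  ∃ (X : Type) (_ : TopologicalSpace X) (_ : T2Space X) (_ : SecondCountableTopology X)
    (_ : ChartedSpace (EuclideanHalfSpace 5) X) (_ : IsManifold (𝓡∂ 5) ∞ X) (_ : CompactSpace X)
    (_ : ConnectedSpace X) (j : N → X) (ι : M → X) (ρ : X → ℝ)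
    (gb : Bundle.ContMDiffRiemannianMetric (𝓡∂ 5) 2 (EuclideanSpace ℝ (Fin 5))
      (TangentSpace (𝓡∂ 5) : X → Type _)),
    Manifold.IsSmoothEmbedding (𝓡 5) (𝓡∂ 5) ∞ j ∧ Set.range j = (𝓡∂ 5).interior X ∧
    Manifold.IsSmoothEmbedding (𝓡 4) (𝓡∂ 5) ∞ ι ∧ Set.range ι = (𝓡∂ 5).boundary X ∧
    ContMDiff (𝓡∂ 5) 𝓘(ℝ, ℝ) ∞ ρ ∧ (∀ x : X, 0 ≤ ρ x) ∧
    (∀ x : X, ρ x = 0 ↔ x ∈ (𝓡∂ 5).boundary X) ∧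
    (∀ y : M, ∃ ν : TangentSpace (𝓡∂ 5) (ι y), gb.inner (ι y) ν ν = 1 ∧
      ∀ v : TangentSpace (𝓡∂ 5) (ι y), gb.inner (ι y) ν v = mfderiv (𝓡∂ 5) 𝓘(ℝ, ℝ) ρ (ι y) v) ∧
    (∀ (x : N) (v w : TangentSpace (𝓡 5) x),
      gb.inner (j x) (mfderiv (𝓡 5) (𝓡∂ 5) j x v) (mfderiv (𝓡 5) (𝓡∂ 5) j x w) =
        ρ (j x) ^ 2 * g.inner x v w) ∧
    (∃ φ : M → ℝ, ∀ y : M, 0 < φ y ∧ ∀ v w : TangentSpace (𝓡 4) y,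
      gb.inner (ι y) (mfderiv (𝓡 4) (𝓡∂ 5) ι y v) (mfderiv (𝓡 4) (𝓡∂ 5) ι y w) =
        φ y * g₀.inner y v w)

/-- **Poincaré–Einstein filling of a closed 4-manifold**: `Ric_g = −4 g` on the 5-dimensional bulk
and `IsConformallyCompactFilling` — the conjunction inlined (in this order) in the items
`PEFillNearRound`, `PEFilledHomotopySpheres`, … of route `SmoothPoincare4/EinsteinBulk`.
[cite: LiQingShi2017, Def. 2.1 (conformally compact Einstein manifold)] -/
def IsPoincareEinsteinFilling (M : Type) [TopologicalSpace M]
    [ChartedSpace (EuclideanSpace ℝ (Fin 4)) M] [IsManifold (𝓡 4) ∞ M]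
    (g₀ : Bundle.ContMDiffRiemannianMetric (𝓡 4) ∞ (EuclideanSpace ℝ (Fin 4))
      (TangentSpace (𝓡 4) : M → Type _))
    (N : Type) [TopologicalSpace N] [ChartedSpace (EuclideanSpace ℝ (Fin 5)) N]
    [IsManifold (𝓡 5) ∞ N]
    (g : Bundle.ContMDiffRiemannianMetric (𝓡 5) ∞ (EuclideanSpace ℝ (Fin 5))
      (TangentSpace (𝓡 5) : N → Type _))
    [(PseudoRiemannianMetric.ofRiemannian g).HasLeviCivita] : Prop :=
  (∀ x, (PseudoRiemannianMetric.ofRiemannian g).ricci x =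
      (-4 : ℝ) • (PseudoRiemannianMetric.ofRiemannian g).toBilinForm x) ∧
    IsConformallyCompactFilling M g₀ N g

/-! ### API -/

section API

variable {M : Type} [TopologicalSpace M] [ChartedSpace (EuclideanSpace ℝ (Fin 4)) M]
  [IsManifold (𝓡 4) ∞ M]
  {g₀ : Bundle.ContMDiffRiemannianMetric (𝓡 4) ∞ (EuclideanSpace ℝ (Fin 4))
    (TangentSpace (𝓡 4) : M → Type _)}
  {N : Type} [TopologicalSpace N] [ChartedSpace (EuclideanSpace ℝ (Fin 5)) N]
  [IsManifold (𝓡 5) ∞ N]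
  {g : Bundle.ContMDiffRiemannianMetric (𝓡 5) ∞ (EuclideanSpace ℝ (Fin 5))
    (TangentSpace (𝓡 5) : N → Type _)}

/-- The dimension-four predicate is the case `n = 4` of the general one (definitional).
[folklore] -/
theorem isConformallyCompactFilling_iff_ofDim :
    IsConformallyCompactFilling M g₀ N g ↔ IsConformallyCompactFillingOfDim 4 M g₀ N g :=
  Iff.rfl

/-- The dimension-four Poincaré–Einstein predicate is the case `n = 4` of the general one.
[folklore] -/
theorem isPoincareEinsteinFilling_iff_ofDim [(PseudoRiemannianMetric.ofRiemannian g).HasLeviCivita] :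
    IsPoincareEinsteinFilling M g₀ N g ↔ IsPoincareEinsteinFillingOfDim 4 M g₀ N g := by
  unfold IsPoincareEinsteinFilling IsPoincareEinsteinFillingOfDim
  rw [isConformallyCompactFilling_iff_ofDim]
  norm_num

/-- A Poincaré–Einstein filling is in particular a conformally compact filling. [folklore] -/
theorem IsPoincareEinsteinFilling.isConformallyCompactFilling
    [(PseudoRiemannianMetric.ofRiemannian g).HasLeviCivita]
    (h : IsPoincareEinsteinFilling M g₀ N g) : IsConformallyCompactFilling M g₀ N g :=
  h.2

/-- The Einstein equation `Ric_g = −4 g` of a Poincaré–Einstein filling. [folklore] -/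
theorem IsPoincareEinsteinFilling.ricci_eq [(PseudoRiemannianMetric.ofRiemannian g).HasLeviCivita]
    (h : IsPoincareEinsteinFilling M g₀ N g) (x : N) :
    (PseudoRiemannianMetric.ofRiemannian g).ricci x =
      (-4 : ℝ) • (PseudoRiemannianMetric.ofRiemannian g).toBilinForm x :=
  h.1 x

/-- A conformally compact filling provides a compactification whose defining function is positive
exactly on the interior (conjuncts (6)–(7)). [folklore] -/
theorem IsConformallyCompactFilling.exists_compactification (h : IsConformallyCompactFilling M g₀ N g) :
    ∃ (X : Type) (_ : TopologicalSpace X) (_ : ChartedSpace (EuclideanHalfSpace 5) X) (j : N → X)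
      (ρ : X → ℝ), Set.range j = (𝓡∂ 5).interior X ∧ ∀ x : X, 0 < ρ x ↔ x ∈ (𝓡∂ 5).interior X := by
  obtain ⟨X, _, _, _, _, _, _, _, j, ι, ρ, gb, -, hj, -, -, -, hρ0, hρb, -⟩ := h
  refine ⟨X, inferInstance, inferInstance, j, ρ, hj, fun x => ?_⟩
  rw [← ModelWithCorners.compl_boundary, Set.mem_compl_iff, ← hρb x]
  constructor
  · intro hx h0
    exact hx.ne' h0
  · intro hx
    exact lt_of_le_of_ne (hρ0 x) (Ne.symm hx)

end API

end Literature.Geometry.Riemannian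

end
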